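import Summits.CriticalPhenomena.PercolationContinuityZ3.Theorems.PercNearOneGluingNoHeavyLowerTailCertRowsTwoSet
import Summits.CriticalPhenomena.PercolationContinuityZ3.Theorems.PercNearOneGluingNoHeavyLowerTailCertGeneral
import Summits.CriticalPhenomena.PercolationContinuityZ3.Theorems.PercNearOneGluingNoHeavyLowerTailTransportRow
import Summits.CriticalPhenomena.PercolationContinuityZ3.Theorems.PercNearOneGluingAdditiveGluingKnLemma3Mixed
import Summits.CriticalPhenomena.PercolationContinuityZ3.Theorems.PercNearOneGluingNoHeavyLowerTailWorstPairExchange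
import HarnessLib

/-!
# `NoHeavyLowerTail` (stmt-CriticalPhenomena-4575) — certificate machine add-on: LINEAR hypothesis rows
# (transport / Kozma–Nitzan mixed Lemma 3 / two-relay event gluing) as `CertCheck.LinRow` data + validity at the cell law

Support file (new-inequality factory, all-graph proof seat `prim-ineq-prove-4`; `--supports stmt-CriticalPhenomena-4575`).
Bookkeeping definitions (`Formula.posFrom`, `transportLo/Hi`, `transportLinRow`), no named facts, no sorries.

The LP certificates for the sharp three-relay event gluing EG₃ / the refined residual (this seat's `wf3sep` runs) use, besides
two-set exchange rows (`CertCells.twoSetRow`), LINEAR hypothesis rows valid under the worst-relay order: the TRANSPORT rows of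
`…TransportRow` — for `a_w` worse than `a_j`, `X ∌ a_w`, `T = X ∪ {a_j}`, `U` increasing in (and read off) the open edge
cluster of `T`:  `μ({a_w↔b} ∩ {a_w↮X} ∩ U) ≤ μ({a_j↔b} ∩ {a_w↮X} ∩ U)`.  In the general checker `CertCheck.checkG/checkQ`
(`…CertGeneral`) such a row is a `LinRow ⟨eLo, eHi, mult, wt⟩` whose validity `linEval x eLo ≤ linEval x eHi` at the cell law
`x` must be supplied (`soundG`, hypothesis `hlrows`).  This file provides it:
* `Formula.posFrom T U` — syntactic test: every literal of the DNF formula `U` is a connection literal `(t, u, true)` with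
  source `t ∈ T` (so `U` denotes an increasing event read off `C_T`);
* `transportLo w b X U` / `transportHi w j b X U` — the two events as formulas; `transportLinRow` — the row as cell lists;
* `transportLinRow_holds` — validity at the cell law of every weighted graph and injective placement with
  `μ{v w ↔ v b} ≤ μ{v j ↔ v b}`, from `TransportRow.transportRow`;
* `Formula.mixedFor j w Q`, `mixedLinRow`, `mixedLinRow_holds` — Kozma–Nitzan Lemma 3 for MIXED events (`Q` increasing in
  `C_{a_j}`, decreasing in `C_{a_w}`; tree `knLemma3Mixed`): `μ({a_w↔b} ∩ Q) ≤ μ({a_j↔b} ∩ Q)`;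
* `eg2LinRow`, `eg2LinRow_holds` — the two-relay event gluing (tree `eventGluing_pair`, Kozma–Nitzan Thm 1 in event form):
  `μ({o↮c} ∩ ({o↔a} ∪ {o↔a'})) ≤ μ{a↮c}` when `μ{a'↮c} ≤ μ{a↮c}`.
[cite: VandenbergHaggstromKahn2005, Thm. 1.3 (p. 6), Thm. 1.4 (p. 7)] [cite: KozmaNitzan2024, Lemma 3 (pp. 6–7)]
-/

noncomputable section

namespace Summit.CriticalPhenomena.PercolationContinuityZ3.Theorems

open MeasureTheory Set Literature.Probability.Percolation
open Literature.Probability.LatticeModels (prodBernoulli)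
open scoped Classical BigOperators
open PatternCells CertCheck

namespace CertCells

variable {n : ℕ}

/-- Syntactic test: every literal of `U` is a positive connection literal with source in `T`. [folklore] -/
def Formula.posFrom (T : List (Fin 5)) (U : Formula) : Bool :=
  U.all fun cl => cl.all fun l => l.2.2 && decide (l.1 ∈ T)

/-- The smaller event of a transport row: `{w ↔ b} ∧ ⋀_{x∈X} {w ↮ x} ∧ U`. [folklore] -/
def transportLo (w b : Fin 5) (X : List (Fin 5)) (U : Formula) : Formula :=
  Formula.conj [(w, b, true) :: X.map fun x => (w, x, false)] U

/-- The larger event of a transport row: `{j ↔ b} ∧ ⋀_{x∈X} {w ↮ x} ∧ U`. [folklore] -/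
def transportHi (w j b : Fin 5) (X : List (Fin 5)) (U : Formula) : Formula :=
  Formula.conj [(j, b, true) :: X.map fun x => (w, x, false)] U

/-- **The transport row as checker data** (`LinRow`: `μ(eLo) ≤ μ(eHi)`). [this file] -/
def transportLinRow (w j b : Fin 5) (X : List (Fin 5)) (U : Formula) (mult : List ℕ) (wt : ℕ) : LinRow :=
  ⟨cellsOf (transportLo w b X U), cellsOf (transportHi w j b X U), mult, wt⟩

/-- The up-set of edge sets denoted by a `posFrom` formula. [folklore] -/
def Formula.upSet (v : Fin 5 → Fin n) (U : Formula) : Set (Set (Sym2 (Fin n))) :=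
  {C | ∃ cl ∈ U, ∀ l ∈ cl, (openGraph C).Reachable (v l.1) (v l.2.1)}

/-- It is an up-set. [folklore] -/
theorem Formula.upSet_isUpperSet (v : Fin 5 → Fin n) (U : Formula) : IsUpperSet (Formula.upSet v U) := by
  intro C C' hCC' hC
  obtain ⟨cl, hcl, h⟩ := hC
  exact ⟨cl, hcl, fun l hl => (h l hl).mono (openGraph_mono hCC')⟩

/-- At `C = C_T(ω)` (`T` placed by `v`, as a Finset `S ∋ v t` for all `t ∈ T`) a `posFrom T` formula's up-set cuts out its event.
[folklore] -/
theorem Formula.upSet_mem_iff (v : Fin 5 → Fin n) (T : List (Fin 5)) (U : Formula) (hU : Formula.posFrom T U = true)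
    (S : Finset (Fin n)) (hS : ∀ t ∈ T, v t ∈ S) (ω : BondConfig (Fin n)) :
    (⋃ s ∈ S, openEdgeCluster ω s) ∈ Formula.upSet v U ↔ ω ∈ U.set v := by
  unfold Formula.upSet Formula.set
  simp only [Set.mem_setOf_eq]
  unfold Formula.posFrom at hU
  rw [List.all_eq_true] at hU
  constructor
  · rintro ⟨cl, hcl, h⟩
    refine ⟨cl, hcl, fun l hl => ?_⟩
    have hl' := hU cl hcl
    rw [List.all_eq_true] at hl'
    have hlit := hl' l hl
    simp only [Bool.and_eq_true, decide_eq_true_eq] at hlit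
    unfold Lit.holds
    have h1 := (knThm2_reachable_biUnion_iff S (hS _ hlit.2) (v l.2.1) ω).1 (h l hl)
    exact ⟨fun _ => hlit.1, fun _ => h1⟩
  · rintro ⟨cl, hcl, h⟩
    refine ⟨cl, hcl, fun l hl => ?_⟩
    have hl' := hU cl hcl
    rw [List.all_eq_true] at hl'
    have hlit := hl' l hl
    simp only [Bool.and_eq_true, decide_eq_true_eq] at hlit
    rw [knThm2_reachable_biUnion_iff S (hS _ hlit.2) (v l.2.1) ω]
    have := h l hl
    unfold Lit.holds at this
    exact this.2 hlit.1

/-- Semantics of the one-clause formula `{a ↔ b} ∧ ⋀_{x∈X} {w ↮ x}`. [folklore] -/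
theorem mem_set_connSep (v : Fin 5 → Fin n) (a w b : Fin 5) (X : List (Fin 5)) (ω : BondConfig (Fin n)) :
    ω ∈ Formula.set v [(a, b, true) :: X.map fun x => (w, x, false)] ↔
      ω ∈ (openConn (v a) (v b) : Set (BondConfig (Fin n))) ∩
        {ω | ∀ x ∈ (X.map v).toFinset, ¬ (openGraph ω).Reachable (v w) x} := by
  rw [mem_set_single]
  simp only [List.mem_cons, List.mem_map, forall_eq_or_imp, forall_exists_index, and_imp,
    forall_apply_eq_imp_iff₂, Set.mem_inter_iff, Set.mem_setOf_eq, List.mem_toFinset, openConn]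
  unfold Lit.holds
  simp only [iff_true, Bool.false_eq_true, iff_false]

/-- **The transport row holds at the cell law** of every weighted graph and injective placement with
`μ{v w ↔ v b} ≤ μ{v j ↔ v b}` (`w ∉ X`, `w ≠ j`, `U` positive with sources in `j :: X`) — admissible `LinRow` input of
`CertCheck.soundG` / `soundQ`. [cite: VandenbergHaggstromKahn2005, Thm. 1.3 (p. 6), Thm. 1.4 (p. 7)] [cite: KozmaNitzan2024, Lemma 3 (pp. 6–7)] -/
theorem transportLinRow_holds (w' : Sym2 (Fin n) → unitInterval) (v : Fin 5 → Fin n) (hv : Function.Injective v)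
    (w j b : Fin 5) (X : List (Fin 5)) (U : Formula) (hU : Formula.posFrom (j :: X) U = true)
    (hwX : w ∉ X) (hwj : w ≠ j)
    (hworst : (prodBernoulli w').real (openConn (v w) (v b)) ≤ (prodBernoulli w').real (openConn (v j) (v b)))
    (mult : List ℕ) (wt : ℕ) :
    let x : ℕ → ℝ := fun m => (prodBernoulli w').real (Cell v m)
    let r := transportLinRow w j b X U mult wt
    linEval x r.eLo ≤ linEval x r.eHi := by
  intro x r
  simp only [r, transportLinRow, x, ← measureReal_set_eq_linEval, transportLo, transportHi, set_conj]
  have hLo : Formula.set v [(w, b, true) :: X.map fun x => (w, x, false)] =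
      (openConn (v w) (v b) : Set (BondConfig (Fin n))) ∩
        {ω | ∀ x ∈ (X.map v).toFinset, ¬ (openGraph ω).Reachable (v w) x} :=
    Set.ext fun ω => mem_set_connSep v w w b X ω
  have hHi : Formula.set v [(j, b, true) :: X.map fun x => (w, x, false)] =
      (openConn (v j) (v b) : Set (BondConfig (Fin n))) ∩
        {ω | ∀ x ∈ (X.map v).toFinset, ¬ (openGraph ω).Reachable (v w) x} :=
    Set.ext fun ω => mem_set_connSep v j w b X ω
  rw [hLo, hHi]
  have haw : v w ∉ (X.map v).toFinset := by
    rw [List.mem_toFinset, List.mem_map]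
    rintro ⟨x, hx, hxw⟩
    exact hwX (hv hxw ▸ hx)
  have hS : ∀ t ∈ j :: X, v t ∈ insert (v j) (X.map v).toFinset := by
    intro t ht
    rcases List.mem_cons.1 ht with rfl | ht
    · exact Finset.mem_insert_self _ _
    · exact Finset.mem_insert_of_mem (List.mem_toFinset.2 (List.mem_map.2 ⟨t, ht, rfl⟩))
  exact TransportRow.transportRow w' (v w) (v j) (v b) (X.map v).toFinset haw (fun h => hwj (hv h))
    (Formula.upSet v U) (Formula.upSet_isUpperSet v U) (U.set v)
    (Formula.upSet_mem_iff v (j :: X) U hU _ hS) hworst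

/-- Worked instance (the factory row `M3`, `X = {o}`, `U = {o ↔ {a₂,a₃}}`, terminals `0=o,1=a₁,2=a₂,3=a₃,4=b`):
`μ(a₁↔b, a₁↮o, o↔{a₂,a₃}) ≤ μ(a₂↔b, a₁↮o, o↔{a₂,a₃})` as a valid `LinRow`. [this file] -/
theorem transportLinRow_example (w' : Sym2 (Fin n) → unitInterval) (v : Fin 5 → Fin n) (hv : Function.Injective v)
    (hworst : (prodBernoulli w').real (openConn (v 1) (v 4)) ≤ (prodBernoulli w').real (openConn (v 2) (v 4))) :
    let x : ℕ → ℝ := fun m => (prodBernoulli w').real (Cell v m)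
    let r := transportLinRow 1 2 4 [0] [[(2, 0, true)], [(0, 3, true)]] [] 1
    linEval x r.eLo ≤ linEval x r.eHi :=
  transportLinRow_holds w' v hv 1 2 4 [0] [[(2, 0, true)], [(0, 3, true)]] (by decide) (by decide) (by decide)
    hworst [] 1

/-! ## Kozma–Nitzan Lemma 3 for mixed events -/

/-- Syntactic test: every literal of `Q` is `(j, u, true)` (increasing in `C_{a_j}`) or `(w, u, false)` (decreasing in `C_{a_w}`).
[folklore] -/
def Formula.mixedFor (j w : Fin 5) (Q : Formula) : Bool :=
  Q.all fun cl => cl.all fun l => (l.2.2 && decide (l.1 = j)) || (!l.2.2 && decide (l.1 = w))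

/-- **The mixed Lemma-3 row as checker data**: `μ({w↔b} ∧ Q) ≤ μ({j↔b} ∧ Q)`. [this file] -/
def mixedLinRow (w j b : Fin 5) (Q : Formula) (mult : List ℕ) (wt : ℕ) : LinRow :=
  ⟨cellsOf (Formula.conj [[(w, b, true)]] Q), cellsOf (Formula.conj [[(j, b, true)]] Q), mult, wt⟩

/-- Growing the open edge cluster of `s` preserves connections from `s`. [folklore] -/
theorem reachable_of_openEdgeCluster_subset {ω ω' : BondConfig (Fin n)} {s a : Fin n}
    (h : openEdgeCluster ω s ⊆ openEdgeCluster ω' s) (hr : (openGraph ω).Reachable s a) :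
    (openGraph ω').Reachable s a := by
  rw [reachable_iff_exists_mem_openEdgeCluster] at hr ⊢
  rcases hr with h1 | ⟨e, he, hae⟩
  · exact Or.inl h1
  · exact Or.inr ⟨e, h he, hae⟩

/-- A `mixedFor j w` formula denotes an event closed under growing `C_{v j}` and shrinking `C_{v w}`. [folklore] -/
theorem Formula.mixed_closed (v : Fin 5 → Fin n) (j w : Fin 5) (Q : Formula) (hQ : Formula.mixedFor j w Q = true)
    (ω ω' : BondConfig (Fin n)) (hω : ω ∈ Q.set v)
    (hj : openEdgeCluster ω (v j) ⊆ openEdgeCluster ω' (v j))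
    (hw : openEdgeCluster ω' (v w) ⊆ openEdgeCluster ω (v w)) : ω' ∈ Q.set v := by
  unfold Formula.set at hω ⊢
  obtain ⟨cl, hcl, h⟩ := hω
  refine ⟨cl, hcl, fun l hl => ?_⟩
  unfold Formula.mixedFor at hQ
  rw [List.all_eq_true] at hQ
  have hl' := hQ cl hcl
  rw [List.all_eq_true] at hl'
  have hlit := hl' l hl
  have hh := h l hl
  unfold Lit.holds at hh ⊢
  simp only [Bool.or_eq_true, Bool.and_eq_true, Bool.not_eq_true', decide_eq_true_eq] at hlit
  rcases hlit with ⟨htrue, h1⟩ | ⟨hfalse, h1⟩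
  · rw [h1] at hh ⊢
    exact ⟨fun _ => htrue, fun _ => reachable_of_openEdgeCluster_subset hj (hh.2 htrue)⟩
  · rw [h1] at hh ⊢
    rw [hfalse]
    simp only [Bool.false_eq_true, iff_false]
    intro hr
    have := reachable_of_openEdgeCluster_subset hw hr
    rw [hh] at this
    exact Bool.false_ne_true (this ▸ hfalse ▸ rfl)

/-- Semantics of `{a ↔ b} ∧ Q`. [folklore] -/
theorem set_conj_conn (v : Fin 5 → Fin n) (a b : Fin 5) (Q : Formula) :
    (Formula.conj [[(a, b, true)]] Q).set v = (openConn (v a) (v b) : Set (BondConfig (Fin n))) ∩ Q.set v := by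
  rw [set_conj]
  congr 1
  ext ω
  rw [mem_set_single]
  simp only [List.mem_singleton, forall_eq, openConn, Set.mem_setOf_eq]
  unfold Lit.holds
  simp only [iff_true]

/-- **The mixed Lemma-3 row holds at the cell law** of every weighted graph and placement with `μ{v w ↔ v b} ≤ μ{v j ↔ v b}`
(`Q` of type `mixedFor j w`). [cite: KozmaNitzan2024, Lemma 3 (pp. 6–7)] [cite: VandenbergHaggstromKahn2005, Thm. 1.5 (p. 7)] -/
theorem mixedLinRow_holds (w' : Sym2 (Fin n) → unitInterval) (v : Fin 5 → Fin n)
    (w j b : Fin 5) (Q : Formula) (hQ : Formula.mixedFor j w Q = true)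
    (hworst : (prodBernoulli w').real (openConn (v w) (v b)) ≤ (prodBernoulli w').real (openConn (v j) (v b)))
    (mult : List ℕ) (wt : ℕ) :
    let x : ℕ → ℝ := fun m => (prodBernoulli w').real (Cell v m)
    let r := mixedLinRow w j b Q mult wt
    linEval x r.eLo ≤ linEval x r.eHi := by
  intro x r
  simp only [r, mixedLinRow, x, ← measureReal_set_eq_linEval, set_conj_conn]
  have key := knLemma3Mixed n w' (v w) (v j) (v b) (Q.set v) 0
    (fun ω ω' hω hj hw => Formula.mixed_closed v j w Q hQ ω ω' hω hj hw) le_rfl (by rw [add_zero]; exact hworst)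
  rw [add_zero] at key
  exact key

/-- Worked instance (factory row `M2`, `Q = {o ↔ a₂} ∩ {a₁ ↮ a₃}`, terminals `0=o,1=a₁,2=a₂,3=a₃,4=b`). [this file] -/
theorem mixedLinRow_example (w' : Sym2 (Fin n) → unitInterval) (v : Fin 5 → Fin n)
    (hworst : (prodBernoulli w').real (openConn (v 1) (v 4)) ≤ (prodBernoulli w').real (openConn (v 2) (v 4))) :
    let x : ℕ → ℝ := fun m => (prodBernoulli w').real (Cell v m)
    let r := mixedLinRow 1 2 4 [[(2, 0, true), (1, 3, false)]] [] 1
    linEval x r.eLo ≤ linEval x r.eHi :=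
  mixedLinRow_holds w' v 1 2 4 [[(2, 0, true), (1, 3, false)]] (by decide) hworst [] 1

/-! ## Two-relay event gluing (Kozma–Nitzan Theorem 1, event form) -/

/-- **The two-relay event-gluing row as checker data**: `μ({o↮c} ∧ ({o↔a} ∨ {o↔a'})) ≤ μ{a↮c}` (`a` the worse relay).
[this file] -/
def eg2LinRow (a a' o c : Fin 5) (mult : List ℕ) (wt : ℕ) : LinRow :=
  ⟨cellsOf [[(o, a, true), (o, c, false)], [(o, a', true), (o, c, false)]], cellsOf [[(a, c, false)]], mult, wt⟩

/-- Semantics of the event-gluing event `{o↮c} ∧ ({o↔a} ∨ {o↔a'})`. [folklore] -/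
theorem set_eg2Lo (v : Fin 5 → Fin n) (a a' o c : Fin 5) :
    Formula.set v [[(o, a, true), (o, c, false)], [(o, a', true), (o, c, false)]] =
      (openConn (v o) (v c) : Set (BondConfig (Fin n)))ᶜ ∩ ⋃ y ∈ ({v a, v a'} : Finset (Fin n)), openConn (v o) y := by
  ext ω
  rw [mem_set_cons, mem_set_single]
  unfold Lit.holds
  simp only [List.mem_cons, List.not_mem_nil, or_false, forall_eq_or_imp, forall_eq, Set.mem_inter_iff,
    Set.mem_compl_iff, Set.mem_iUnion, Finset.mem_insert, Finset.mem_singleton, exists_prop, openConn,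
    Set.mem_setOf_eq, iff_true, Bool.false_eq_true, iff_false]
  constructor
  · rintro (⟨ha, hc⟩ | ⟨ha', hc⟩)
    · exact ⟨hc, v a, Or.inl rfl, ha⟩
    · exact ⟨hc, v a', Or.inr rfl, ha'⟩
  · rintro ⟨hc, y, hy | hy, hr⟩
    · exact Or.inl ⟨hy ▸ hr, hc⟩
    · exact Or.inr ⟨hy ▸ hr, hc⟩

/-- Semantics of `{a ↮ c}`. [folklore] -/
theorem set_notConn (v : Fin 5 → Fin n) (a c : Fin 5) :
    Formula.set v [[(a, c, false)]] = (openConn (v a) (v c) : Set (BondConfig (Fin n)))ᶜ := by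
  ext ω
  rw [mem_set_single]
  simp only [List.mem_singleton, forall_eq, Set.mem_compl_iff, openConn, Set.mem_setOf_eq]
  unfold Lit.holds
  simp only [Bool.false_eq_true, iff_false]

/-- **The two-relay event-gluing row holds at the cell law** of every weighted graph and injective placement with
`μ{v a' ↮ v c} ≤ μ{v a ↮ v c}` (`a ≠ a'`). [cite: KozmaNitzan2024, Theorem 1 (p. 7)] -/
theorem eg2LinRow_holds (w' : Sym2 (Fin n) → unitInterval) (v : Fin 5 → Fin n) (hv : Function.Injective v)
    (a a' o c : Fin 5) (haa : a ≠ a')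
    (hle : (prodBernoulli w').real (openConn (v a') (v c) : Set (BondConfig (Fin n)))ᶜ ≤
      (prodBernoulli w').real (openConn (v a) (v c) : Set (BondConfig (Fin n)))ᶜ)
    (mult : List ℕ) (wt : ℕ) :
    let x : ℕ → ℝ := fun m => (prodBernoulli w').real (Cell v m)
    let r := eg2LinRow a a' o c mult wt
    linEval x r.eLo ≤ linEval x r.eHi := by
  intro x r
  simp only [r, eg2LinRow, x, ← measureReal_set_eq_linEval, set_eg2Lo, set_notConn]
  exact eventGluing_pair w' (v o) (v c) (v a) (v a') (fun h => haa (hv h)) _ le_rfl hle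

/-- Worked instance: `μ(o↮b, o↔{a₂,a₃}) ≤ μ(a₂↮b)` when `μ(a₃↮b) ≤ μ(a₂↮b)` (terminals `0=o,2=a₂,3=a₃,4=b`). [this file] -/
theorem eg2LinRow_example (w' : Sym2 (Fin n) → unitInterval) (v : Fin 5 → Fin n) (hv : Function.Injective v)
    (hle : (prodBernoulli w').real (openConn (v 3) (v 4) : Set (BondConfig (Fin n)))ᶜ ≤
      (prodBernoulli w').real (openConn (v 2) (v 4) : Set (BondConfig (Fin n)))ᶜ) :
    let x : ℕ → ℝ := fun m => (prodBernoulli w').real (Cell v m)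
    let r := eg2LinRow 2 3 0 4 [] 1
    linEval x r.eLo ≤ linEval x r.eHi :=
  eg2LinRow_holds w' v hv 2 3 0 4 (by decide) hle [] 1

end CertCells

end Summit.CriticalPhenomena.PercolationContinuityZ3.Theorems

end
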